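import Literature.NumberTheory.EllipticCurves.DivisionField
import Literature.NumberTheory.EllipticCurves.DivisionFieldDegreeProofs
import HarnessLib

/-!
# [IUTchIV] Theorem 1.10 / [IUTchI] Def. 3.1 (a)(b): the field `F = F_mod(√−1, E_{F_mod}[2·3·5])` of a model
# over `F_mod` — Galois over `F_mod`, of degree dividing `2·|GL₂(𝔽₂)|·|GL₂(𝔽₃)|·|GL₂(𝔽₅)|`,
# carrying the `30`-torsion

Mochizuki, *Inter-universal Teichmüller theory IV*, RIMS manuscript (Apr. 2020; = PRIMS **57** (2021)),
Thm. 1.10, p. 22: "we assume that the `(3·5)`-torsion points of `E_F` are defined over `F`, and that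
`F = F_mod(√−1, E_{F_mod}[2·3·5]) := F_tpd(√−1, E_{F_tpd}[3·5])`"; [IUTchI] Def. 3.1 (a) "`√−1 ∈ F`", (b) "the
field extension `F/F_mod` is Galois of degree prime to `l`, and the `2·3`-torsion points of `E_F` are rational
over `F`" (kurims pp. 61–62); Step (ii) of the proof of Thm. 1.10, p. 24: "a natural outer inclusion
`Gal(F/F_tpd) ↪ GL₂(𝔽₃) × GL₂(𝔽₅) × ℤ/2ℤ`", (E3)(E4): `|GL₂(𝔽_p)| = p(p+1)(p−1)²`, `2·3`, `3·2⁴`, `5·2⁵·3`.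

Following the route owner's ruling on FLAG CANDIDATE F4 (abc-iut-plan 2026-08-25T23:31:36Z; finding
F-L5t7-1: with the printed Legendre model over `F_tpd` the field `F` need NOT be Galois over `F_mod`), this
file builds the field of the FIRST description for a MODEL `W` OVER `F_mod =: K₀` (any number field `K₀` and
any elliptic `W/K₀`), inside `K̄₀ := AlgebraicClosure K₀`, and PROVES (classical Galois theory over the tree's
division fields `WeierstrassCurve.divisionField`, abc-iut/bsd seats, and abc-iut-S5's degree bounds):
* `thetaDataField W := K₀(√−1) ⊔ K₀(W[2]) ⊔ K₀(W[3]) ⊔ K₀(W[5]) ⊆ K̄₀`, a number field;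
* (a) `√−1 ∈ thetaDataField W` (`exists_sq_eq_neg_one`);
* (b) **`IsGalois K₀ (thetaDataField W)`** (its fixing group is an intersection of normal subgroups);
* (b) **`[thetaDataField W : K₀] ∣ 2·6·48·480 = 2^11·3^3·5`** (`finrank_thetaDataField_dvd`; the printed
  `Gal ↪ GL₂(𝔽₂) × GL₂(𝔽₃) × GL₂(𝔽₅) × ℤ/2ℤ` as an index divisibility), hence **prime to every prime `l ≥ 7`**
  (`finrank_thetaDataField_coprime`);
* (b) every `K̄₀`-point of `W` killed by `30` is fixed by `Gal(K̄₀/thetaDataField W)` and has its coordinates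
  in `thetaDataField W` (`smul_eq_of_mem_fixingSubgroup`, `coord_mem_thetaDataField`) — "the `(2·3·5)`-torsion
  points are rational over `F`".
The packaging into `InitialThetaData` (via `InitialThetaData.ofArith`, `InitialThetaDataArith.lean`) for
`E_F := W ⊗ F` is the companion instantiation file. Nothing here takes a side on [IUTchIII] Cor. 3.12.
-/

noncomputable section

open scoped Classical
open Field IntermediateField Polynomial
open Literature.NumberTheory.EllipticCurves Literature.NumberTheory.GaloisRepresentations

universe u

namespace Literature.IUT.HodgeTheaters

variable {K₀ : Type u} [Field K₀] [NumberField K₀] (W : WeierstrassCurve K₀) [W.IsElliptic]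

/-! ## `√−1 ∈ K̄₀` and the field `K₀(√−1, W[2·3·5])` -/

variable (K₀) in
/-- A square root of `−1` in `K̄₀` (algebraically closed). [claim: Mochizuki2012, status: disputed] -/
def sqrtNegOne : AlgebraicClosure K₀ :=
  Classical.choose (IsAlgClosed.exists_pow_nat_eq (-1 : AlgebraicClosure K₀) two_pos)

variable (K₀) in
omit [NumberField K₀] in
/-- `(√−1)² = −1`. [claim: Mochizuki2012, status: disputed] -/
theorem sqrtNegOne_sq : sqrtNegOne K₀ ^ 2 = -1 :=
  Classical.choose_spec (IsAlgClosed.exists_pow_nat_eq (-1 : AlgebraicClosure K₀) two_pos)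

variable (K₀) in
omit [NumberField K₀] in
/-- `√−1` is integral over `K₀` (a root of `X² + 1`). [claim: Mochizuki2012, status: disputed] -/
theorem isIntegral_sqrtNegOne : IsIntegral K₀ (sqrtNegOne K₀) :=
  Algebra.IsIntegral.isIntegral _

/-- **`F := K₀(√−1, W[2·3·5]) ⊆ K̄₀`** for a model `W` over `K₀ = F_mod` ([IUTchIV] Thm. 1.10, p. 22:
"`F = F_mod(√−1, E_{F_mod}[2·3·5])`"): the compositum of `K₀(√−1)` and the `2`-, `3`-, `5`-division fields.
[claim: Mochizuki2012, status: disputed] -/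
def thetaDataField : IntermediateField K₀ (AlgebraicClosure K₀) :=
  K₀⟮sqrtNegOne K₀⟯ ⊔ W.divisionField 2 ⊔ W.divisionField 3 ⊔ W.divisionField 5

/-- `K₀(√−1)` is finite over `K₀`. [claim: Mochizuki2012, status: disputed] -/
instance finiteDimensional_adjoin_sqrtNegOne :
    FiniteDimensional K₀ (K₀⟮sqrtNegOne K₀⟯ : IntermediateField K₀ (AlgebraicClosure K₀)) :=
  adjoin.finiteDimensional (isIntegral_sqrtNegOne K₀)

/-- `F` is finite over `K₀`. [claim: Mochizuki2012, status: disputed] -/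
instance finiteDimensional_thetaDataField : FiniteDimensional K₀ (thetaDataField W) := by
  haveI : NeZero (3 : ℕ) := ⟨by norm_num⟩
  haveI : NeZero (5 : ℕ) := ⟨by norm_num⟩
  unfold thetaDataField
  infer_instance

/-- `F` is a number field. [claim: Mochizuki2012, status: disputed] -/
instance numberField_thetaDataField : NumberField (thetaDataField W) :=
  NumberField.of_module_finite K₀ (thetaDataField W)

omit [NumberField K₀] [W.IsElliptic] in
/-- `K₀(√−1) ⊆ F`. [claim: Mochizuki2012, status: disputed] -/
theorem adjoin_sqrtNegOne_le :
    (K₀⟮sqrtNegOne K₀⟯ : IntermediateField K₀ (AlgebraicClosure K₀)) ≤ thetaDataField W := by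
  unfold thetaDataField
  exact le_sup_left.trans (le_sup_left.trans le_sup_left)

omit [NumberField K₀] [W.IsElliptic] in
/-- (a) `√−1 ∈ F`. [claim: Mochizuki2012, status: disputed] -/
theorem sqrtNegOne_mem : sqrtNegOne K₀ ∈ thetaDataField W :=
  adjoin_sqrtNegOne_le W (mem_adjoin_simple_self K₀ _)

omit [NumberField K₀] [W.IsElliptic] in
/-- (a) "`√−1 ∈ F`" ([IUTchI] Def. 3.1 (a)). [claim: Mochizuki2012, status: disputed] -/
theorem exists_sq_eq_neg_one : ∃ i : thetaDataField W, i ^ 2 = -1 := by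
  refine ⟨⟨sqrtNegOne K₀, sqrtNegOne_mem W⟩, ?_⟩
  apply Subtype.ext
  simp [sqrtNegOne_sq K₀]

omit [NumberField K₀] [W.IsElliptic] in
/-- `K₀(W[2]), K₀(W[3]), K₀(W[5]) ⊆ F`. [claim: Mochizuki2012, status: disputed] -/
theorem divisionField_le :
    W.divisionField 2 ≤ thetaDataField W ∧ W.divisionField 3 ≤ thetaDataField W ∧
      W.divisionField 5 ≤ thetaDataField W := by
  unfold thetaDataField
  refine ⟨?_, ?_, le_sup_right⟩
  · exact le_sup_right.trans (le_sup_left.trans le_sup_left)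
  · exact le_sup_right.trans le_sup_left

/-! ## (b) Galois -/

omit [NumberField K₀] [W.IsElliptic] in
/-- The fixing group of `F` is the intersection of the four fixing groups. [claim: Mochizuki2012, status: disputed] -/
theorem fixingSubgroup_thetaDataField :
    (thetaDataField W).fixingSubgroup =
      (K₀⟮sqrtNegOne K₀⟯ : IntermediateField K₀ (AlgebraicClosure K₀)).fixingSubgroup ⊓
        (W.divisionField 2).fixingSubgroup ⊓ (W.divisionField 3).fixingSubgroup ⊓
          (W.divisionField 5).fixingSubgroup := by
  unfold thetaDataField
  rw [fixingSubgroup_sup, fixingSubgroup_sup, fixingSubgroup_sup]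

/-- `[K₀(√−1) : K₀] ∣ 2` ((E5): "the degree of the extension `F_mod(√−1)/F_mod` is `≤ 2`").
[claim: Mochizuki2012, status: disputed] -/
theorem finrank_adjoin_sqrtNegOne_dvd_two :
    Module.finrank K₀ (K₀⟮sqrtNegOne K₀⟯ : IntermediateField K₀ (AlgebraicClosure K₀)) ∣ 2 := by
  rw [adjoin.finrank (isIntegral_sqrtNegOne K₀)]
  have hroot : aeval (sqrtNegOne K₀) (X ^ 2 + 1 : K₀[X]) = 0 := by
    simp [sqrtNegOne_sq K₀]
  have hdvd : minpoly K₀ (sqrtNegOne K₀) ∣ (X ^ 2 + 1 : K₀[X]) := minpoly.dvd K₀ _ hroot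
  have hne : (X ^ 2 + 1 : K₀[X]) ≠ 0 := by
    intro h
    have := congrArg (fun p : K₀[X] => p.eval 0) h
    norm_num at this
  have h2 : (X ^ 2 + 1 : K₀[X]).natDegree = 2 := by compute_degree!
  have hdeg : (minpoly K₀ (sqrtNegOne K₀)).natDegree ≤ 2 := by
    have := natDegree_le_of_dvd hdvd hne
    rwa [h2] at this
  have hpos : 0 < (minpoly K₀ (sqrtNegOne K₀)).natDegree :=
    minpoly.natDegree_pos (isIntegral_sqrtNegOne K₀)
  interval_cases (minpoly K₀ (sqrtNegOne K₀)).natDegree <;> norm_num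

/-- `Gal(K̄₀/K₀(√−1))` is a normal subgroup of `Gal(K̄₀/K₀)` (index `≤ 2`). [claim: Mochizuki2012, status: disputed] -/
theorem normal_fixingSubgroup_adjoin_sqrtNegOne :
    ((K₀⟮sqrtNegOne K₀⟯ : IntermediateField K₀ (AlgebraicClosure K₀)).fixingSubgroup).Normal := by
  haveI : IsGalois K₀ (AlgebraicClosure K₀) := {}
  have hidx : ((K₀⟮sqrtNegOne K₀⟯ : IntermediateField K₀ (AlgebraicClosure K₀)).fixingSubgroup).index ∣ 2 := by
    rw [← finrank_eq_fixingSubgroup_index]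
    exact finrank_adjoin_sqrtNegOne_dvd_two
  rcases (Nat.dvd_prime Nat.prime_two).mp hidx with h1 | h2
  · rw [Subgroup.index_eq_one] at h1
    rw [h1]
    infer_instance
  · exact Subgroup.normal_of_index_eq_two h2

/-- `Gal(K̄₀/K₀(W[n]))` is normal (`n ∈ {2,3,5}`; the kernel of the action on `W[n]`).
[claim: Mochizuki2012, status: disputed] -/
theorem normal_fixingSubgroup_divisionField (n : ℕ) [NeZero n] :
    ((W.divisionField n).fixingSubgroup).Normal := by
  rw [W.fixingSubgroup_divisionField n]
  exact W.fixingSubgroupOfModule_geomTorsion_normal n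

/-- **(b) `F/K₀` is Galois** ("the field extension `F/F_mod` is Galois", [IUTchI] Def. 3.1 (b) — for the
`F_mod`-model description of `F`). [claim: Mochizuki2012, status: disputed] -/
instance isGalois_thetaDataField : IsGalois K₀ (thetaDataField W) := by
  haveI : IsGalois K₀ (AlgebraicClosure K₀) := {}
  haveI : NeZero (3 : ℕ) := ⟨by norm_num⟩
  haveI : NeZero (5 : ℕ) := ⟨by norm_num⟩
  rw [← InfiniteGalois.normal_iff_isGalois, fixingSubgroup_thetaDataField]
  haveI := normal_fixingSubgroup_adjoin_sqrtNegOne (K₀ := K₀)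
  haveI := normal_fixingSubgroup_divisionField W 2
  haveI := normal_fixingSubgroup_divisionField W 3
  haveI := normal_fixingSubgroup_divisionField W 5
  infer_instance

/-! ## (b) The degree `[F : K₀] ∣ 2·6·48·480` and its coprimality to `l ≥ 7` -/

/-- The index of an intersection with a NORMAL finite-index subgroup divides the product of the indices.
[claim: Mochizuki2012, status: disputed] -/
theorem index_inf_dvd_mul {G : Type*} [Group G] (H N : Subgroup G) [H.Normal] :
    (H ⊓ N).index ∣ H.index * N.index := by
  rw [← Subgroup.relIndex_mul_index (inf_le_right : H ⊓ N ≤ N), Subgroup.inf_relIndex_right]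
  exact Nat.mul_dvd_mul_right (Subgroup.relIndex_dvd_index_of_normal H N) N.index

/-- `[K₀(W[p]) : K₀] ∣ p(p−1)²(p+1) = |GL₂(𝔽_p)|` ((E3); abc-iut-S5's `finrank_dvd_of_ker_galoisRepTorsion_le_fixingSubgroup`),
stated for the fixing group index. [claim: Mochizuki2012, status: disputed] -/
theorem index_fixingSubgroup_divisionField_dvd (p : ℕ) [hp : Fact p.Prime] :
    ((W.divisionField p).fixingSubgroup).index ∣ p * (p - 1) ^ 2 * (p + 1) := by
  haveI : IsGalois K₀ (AlgebraicClosure K₀) := {}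
  haveI : NeZero p := ⟨hp.out.ne_zero⟩
  rw [← finrank_eq_fixingSubgroup_index]
  refine W.finrank_dvd_of_ker_galoisRepTorsion_le_fixingSubgroup p (W.divisionField p) ?_
  rw [W.fixingSubgroup_divisionField p]
  intro σ hσ
  rw [W.mem_fixingSubgroupOfModule_geomTorsion_iff]
  intro T
  have h := W.galoisRepTorsion_apply (p : ℤ) σ T
  rw [MonoidHom.mem_ker] at hσ
  rw [hσ] at h
  simpa using h.symm

/-- **(b) `[F : K₀] ∣ 2·6·48·480`** (`= 2·|GL₂(𝔽₂)|·|GL₂(𝔽₃)|·|GL₂(𝔽₅)| = 276480 = 2^11·3^3·5`; Step (ii) of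
the proof of Thm. 1.10, p. 24, (E3)–(E5)). [claim: Mochizuki2012, status: disputed] -/
theorem finrank_thetaDataField_dvd : Module.finrank K₀ (thetaDataField W) ∣ 2 * 6 * 48 * 480 := by
  haveI : IsGalois K₀ (AlgebraicClosure K₀) := {}
  haveI : NeZero (3 : ℕ) := ⟨by norm_num⟩
  haveI : NeZero (5 : ℕ) := ⟨by norm_num⟩
  haveI : Fact (Nat.Prime 2) := ⟨Nat.prime_two⟩
  haveI : Fact (Nat.Prime 3) := ⟨Nat.prime_three⟩
  haveI : Fact (Nat.Prime 5) := ⟨by norm_num⟩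
  rw [finrank_eq_fixingSubgroup_index, fixingSubgroup_thetaDataField]
  haveI := normal_fixingSubgroup_adjoin_sqrtNegOne (K₀ := K₀)
  haveI := normal_fixingSubgroup_divisionField W 2
  haveI := normal_fixingSubgroup_divisionField W 3
  haveI := normal_fixingSubgroup_divisionField W 5
  have h2 := index_fixingSubgroup_divisionField_dvd W 2
  have h3 := index_fixingSubgroup_divisionField_dvd W 3
  have h5 := index_fixingSubgroup_divisionField_dvd W 5
  have hi : ((K₀⟮sqrtNegOne K₀⟯ : IntermediateField K₀ (AlgebraicClosure K₀)).fixingSubgroup).index ∣ 2 := by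
    rw [← finrank_eq_fixingSubgroup_index]
    exact finrank_adjoin_sqrtNegOne_dvd_two
  norm_num at h2 h3 h5
  refine (index_inf_dvd_mul _ _).trans ?_
  refine (Nat.mul_dvd_mul ((index_inf_dvd_mul _ _).trans (Nat.mul_dvd_mul
    ((index_inf_dvd_mul _ _).trans (Nat.mul_dvd_mul hi h2)) h3)) h5).trans ?_
  norm_num

/-- **(b) `[F : K₀]` is prime to every prime `l ≥ 7`** ("of degree prime to `l`", [IUTchI] Def. 3.1 (b)).
[claim: Mochizuki2012, status: disputed] -/
theorem finrank_thetaDataField_coprime {l : ℕ} (hl : l.Prime) (h7 : 7 ≤ l) :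
    (Module.finrank K₀ (thetaDataField W)).Coprime l := by
  have hd := finrank_thetaDataField_dvd W
  refine Nat.Coprime.coprime_dvd_left hd ?_
  rw [Nat.Coprime, Nat.gcd_comm]
  rw [← Nat.Coprime, Nat.Prime.coprime_iff_not_dvd hl]
  intro h
  have h' : l ∣ 2 ^ 11 * 3 ^ 3 * 5 := by norm_num at h ⊢; exact h
  rcases (Nat.Prime.dvd_mul hl).mp h' with h12 | h5
  · rcases (Nat.Prime.dvd_mul hl).mp h12 with h2 | h3
    · have := Nat.le_of_dvd (by norm_num) (Nat.Prime.dvd_of_dvd_pow hl h2); omega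
    · have := Nat.le_of_dvd (by norm_num) (Nat.Prime.dvd_of_dvd_pow hl h3); omega
  · have := Nat.le_of_dvd (by norm_num) h5; omega

/-! ## (b) The `30`-torsion is rational over `F` -/

/-- An element of `Gal(K̄₀/F)` fixes every `K̄₀`-point of `W` killed by `30` (it fixes the `2`-, `3`-,
`5`-torsion, and `T = 15T + 10T + 6T`). [claim: Mochizuki2012, status: disputed] -/
theorem smul_eq_of_mem_fixingSubgroup {σ : absoluteGaloisGroup K₀}
    (hσ : σ ∈ (thetaDataField W).fixingSubgroup) (T : W.geomPoints) (hT : (30 : ℤ) • T = 0) :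
    σ • T = T := by
  rw [fixingSubgroup_thetaDataField] at hσ
  have h5' : σ ∈ ((W.divisionField 5).fixingSubgroup : Subgroup (absoluteGaloisGroup K₀)) :=
    (Subgroup.mem_inf.mp hσ).2
  have h3' : σ ∈ ((W.divisionField 3).fixingSubgroup : Subgroup (absoluteGaloisGroup K₀)) :=
    (Subgroup.mem_inf.mp (Subgroup.mem_inf.mp hσ).1).2
  have h2' : σ ∈ ((W.divisionField 2).fixingSubgroup : Subgroup (absoluteGaloisGroup K₀)) :=
    (Subgroup.mem_inf.mp (Subgroup.mem_inf.mp (Subgroup.mem_inf.mp hσ).1).1).2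
  haveI : NeZero (3 : ℕ) := ⟨by norm_num⟩
  haveI : NeZero (5 : ℕ) := ⟨by norm_num⟩
  rw [W.fixingSubgroup_divisionField] at h2' h3' h5'
  have h2 : ∀ S : W.geomTorsion ((2 : ℕ) : ℤ), σ • S = S :=
    (W.mem_fixingSubgroupOfModule_geomTorsion_iff 2).mp h2'
  have h3 : ∀ S : W.geomTorsion ((3 : ℕ) : ℤ), σ • S = S :=
    (W.mem_fixingSubgroupOfModule_geomTorsion_iff 3).mp h3'
  have h5 : ∀ S : W.geomTorsion ((5 : ℕ) : ℤ), σ • S = S :=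
    (W.mem_fixingSubgroupOfModule_geomTorsion_iff 5).mp h5'
  have fix : ∀ (n : ℕ) (m : ℤ), (n : ℤ) * m = 30 →
      (∀ S : W.geomTorsion (n : ℤ), σ • S = S) → σ • (m • T) = m • T := by
    intro n m hnm hfix
    have hmem : m • T ∈ W.geomTorsion (n : ℤ) :=
      (Submodule.mem_torsionBy_iff (n : ℤ) (m • T)).mpr (by rw [smul_smul, hnm, hT])
    have := congrArg Subtype.val (hfix ⟨m • T, hmem⟩)
    rwa [AddSubgroup.torsionBy.coe_smul] at this
  have e2 := fix 2 15 (by norm_num) h2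
  have e3 := fix 3 10 (by norm_num) h3
  have e5 := fix 5 6 (by norm_num) h5
  have hdec : T = (15 : ℤ) • T + (10 : ℤ) • T + (6 : ℤ) • T := by
    have : (15 : ℤ) • T + (10 : ℤ) • T + (6 : ℤ) • T = (31 : ℤ) • T := by
      rw [← add_smul, ← add_smul]; norm_num
    rw [this, show (31 : ℤ) = 1 + 30 by norm_num, add_smul, one_smul, hT, add_zero]
  conv_lhs => rw [hdec]
  rw [smul_add, smul_add, e2, e3, e5, ← hdec]

/-- **The coordinates of every `30`-torsion point of `W(K̄₀)` lie in `F`** ("the `(2·3·5)`-torsion points … are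
defined over `F`"). [claim: Mochizuki2012, status: disputed] -/
theorem coord_mem_thetaDataField {T : W.geomPoints} (hT : (30 : ℤ) • T = 0) {x y : AlgebraicClosure K₀}
    {h : (W.baseChange (AlgebraicClosure K₀)).toAffine.Nonsingular x y}
    (hxy : T = WeierstrassCurve.Affine.Point.some x y h) :
    x ∈ thetaDataField W ∧ y ∈ thetaDataField W := by
  haveI : IsGalois K₀ (AlgebraicClosure K₀) := {}
  have key : ∀ σ ∈ (thetaDataField W).fixingSubgroup, σ • x = x ∧ σ • y = y := by
    intro σ hσ
    have hval := smul_eq_of_mem_fixingSubgroup W hσ T hT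
    rw [hxy] at hval
    have hmap : WeierstrassCurve.Affine.Point.map
        ((show AlgebraicClosure K₀ ≃ₐ[K₀] AlgebraicClosure K₀ from σ) :
          AlgebraicClosure K₀ →ₐ[K₀] AlgebraicClosure K₀) (WeierstrassCurve.Affine.Point.some x y h) =
        WeierstrassCurve.Affine.Point.some x y h := hval
    rw [WeierstrassCurve.Affine.Point.map_some] at hmap
    simp only [WeierstrassCurve.Affine.Point.some.injEq] at hmap
    exact ⟨hmap.1, hmap.2⟩
  rw [← InfiniteGalois.fixedField_fixingSubgroup (thetaDataField W)]
  exact ⟨(mem_fixedField_iff _ _).mpr fun σ hσ => (key σ hσ).1,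
    (mem_fixedField_iff _ _).mpr fun σ hσ => (key σ hσ).2⟩

end Literature.IUT.HodgeTheaters

end
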